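import Summits.BirchSwinnertonDyer.BirchSwinnertonDyer.Theses.GenusKolyvaginAtTwo
import Summits.BirchSwinnertonDyer.BirchSwinnertonDyer.Theorems.GenusKolyvaginAtTwoLeafCensusShaCellSplit
import Summits.BirchSwinnertonDyer.BirchSwinnertonDyer.Theorems.GenusKolyvaginAtTwoRankOneShaCellBSDTwoCleanDescentAtTwo
import Summits.BirchSwinnertonDyer.BirchSwinnertonDyer.Theorems.GenusKolyvaginAtTwoRankOneShaCellBSDTwoShaTwoPrimarySquare
import Summits.BirchSwinnertonDyer.BirchSwinnertonDyer.Theorems.GenusKolyvaginAtTwoCasselsTatePairingRat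
import Summits.BirchSwinnertonDyer.BirchSwinnertonDyer.Theorems.GenusKolyvaginAtTwoRankOneShaCellBSDTwoLocalTwoTorsionParity
import Summits.BirchSwinnertonDyer.BirchSwinnertonDyer.Theorems.GenusKolyvaginAtTwoRankOneShaCellBSDTwoShaBookkeepingOfFacts
import HarnessLib

/-!

**v2.0 PROPOSAL (2026-08-31, LEAD bsd-line-gk2-p1 g33 — for the pen's word; NOT registered)** — TWO PRINT-GRADE STUBS CLOSED IN
THE KERNEL: PAR `stub_localTwoTorsionParity := …LocalParity.localTwoTorsionParity_holds` (p817974/p819091, OUTRIGHT) and ISO₂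
`stub_shaQuadraticBookkeeping : MultPublishedInputsAtTwo → MilneAnyModel → ShaQuadraticBookkeepingAtTwo :=
…Bookkeeping.shaQuadraticBookkeepingAtTwo_of_facts` (p819543; RIDER R-LEAD-41c: ISO₂ needs the two PRINT binders GZK + Milne
any-model, both already conjuncts of `stub_printFacts`, exactly as RIG needed GZK + modularity).  Consequences: `stub_printFacts` moves
above the RIG⁺ wiring (it is now consumed there), `stub_twinSplitInjects` feeds `stub_printFacts.2.2.2.1` (= `MilneAnyModel`) to ISO₂;
everything else byte-identical to v1.9.  Farm check of this file: rc 0 · sorries 4 = WALL · K-ANN₁ · NDIV|Ш-slack · PRINT (v1.9: 6).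
Active stubs after registration: `stub_wallRankZeroAtTwo`, `stub_heegnerIndexUpperOneBit`, `stub_heegnerIndexLowerSlack`,
`stub_printFacts` (RIG, SQ, RIG⁺, PAR, ISO₂ kernel-closed modulo the PRINT conjuncts).  BSD is not proved; 27477 is not closed.

**v1.9 (2026-08-31, bsd-idea-1 g30)** — crit-5 #634 P1 PAID IN KERNEL: RIG⁺ `stub_twinSplitInjects` is DERIVED sorry-free from two PRINT-grade stubs ISO₂ `stub_shaQuadraticBookkeeping` + PAR `stub_localTwoTorsionParity` and the two PRINT facts (`twinSplitInjects_of_iso_par`; no WALL row: infinite `Ш(W_K)[2^∞]` ⟹ `Nat.card = 0`).  Stub ledger: WALL (items) · K-ANN₁ (research XL) · SQ ✓ · RIG ✓ · RIG⁺ ✓(derived) · ISO₂ (print L) · PAR (print M, birth skeleton `bc/par_birth.lean`) · NDIV-slack (research) · PRINT — the audit now shows the line's beyond-print set = {K-ANN₁} ∪ {NDIV-slack} in KERNEL, not prose.  No summit is proved by a line.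

**v1.8 (2026-08-31, pen/ideator bsd-idea-1 g30)** — SQ `stub_shaTwoPrimarySquare` CLOSED BY NAME OUTRIGHT (LEAD p810985 `shaTwoPrimarySquare_of_casselsTate` ∘ tree `WeierstrassCurve.exists_casselsTate_pairing_holds`); stubs now 7 with TWO closed (RIG v1.7, SQ v1.8) and FIVE sorried: WALL (items) · K-ANN₁ (research, XL) · RIG⁺ (provable-grade: ISO₂ = tree fact `Milne1972.bsdQuotientP_baseChange_relQuadratic_anyModel` + bookkeeping + PAR, PAR birth skeleton `bc/par_birth.lean`) · NDIV-slack (research) · PRINT (items + 2 facts).  Composition `RankOneShaCellBSDTwo_of` byte-identical.  No summit is proved by a line.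

# LINE 41 «restriction_rigidity» on the Ш-cell crux `RankOneShaCellBSDTwo` (stmt-BirchSwinnertonDyer-27477, binder hSha of `closes`,
# route `GenusKolyvaginAtTwo` rev 71) — v1.7, SEVEN stubs (ONE CLOSED by name: RIG, via LEAD p809687; SIX open): WALL row 1 · K-ANN₁ · SQ · RIG · RIG⁺ · NDIV|Ш-slack · PRINT×6 (DIV|Ш derived)

Ideator seat `bsd-idea-1` g30 (planner, technique card «compactness–contradiction / rigidity»), 2026-08-31.  A LINE, not a proof: **no summit, no crux,
no wall row and no stub is proved here; BSD is NOT proved by a line.**  Unregistered (W-79): published as a crux workfile / evidence only.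

THE CELL.  `RankOneShaCellBSDTwo`: every non-CM globally minimal `W/ℚ` with `r_an(W) = 1`, `W(ℚ)[2] = 0` and `#Sel₂(W) ≠ 2` satisfies BSD₂.  Since
`rank W(ℚ) = 1` (Gross–Zagier–Kolyvagin) and `W(ℚ)[2] = 0`, `#Sel₂(W) = 2 · #Ш(W/ℚ)[2]`, so the cell is EXACTLY the rank-one curves with `Ш(W/ℚ)[2] ≠ 0`
(`#Sel₂(W) = 2^{s}`, `s − 1 = dim Ш(W)[2] ≥ 2` even by Cassels–Tate).  The only skeleton so far (gk2-p2 g30 `Cruxes/MinimalTwinBSDTwo/Lines/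
sha_cell_kex0_proposal_gk2p2.lean`) has ONE research stub, LEAD g32's hypothesis KEX⁰|Ш of p801119
(`…Census.ShaCell.shaCell_of_wall_of_friedbergHoffstein_of_kex0Sha_of_facts`): at every odd Heegner frame `K` with `2` split and `L(W^{(d_K)},1) ≠ 0`,
SOME exact `2`-depth `2^{M₀} ∥ P(1)` in `W(K[1])` has `#Ш(W_K)[2^∞] · 4^{t} = 4^{M₀}`, `t := ord₂ c_{Dt} + ord₂ C(W)`.

THE LEVER (restriction rigidity — what is special about THIS cell).  On a Ш-cell frame the twin `W^{(d_K)}(ℚ)` is FINITE OF ODD ORDER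
(`L(W^{(d_K)},1) ≠ 0` ⟹ rank `0`; `W^{(d_K)}[2] ≅ W[2]` has no rational point), so the inflation kernel `H¹(Gal(K/ℚ), W(K)) = W(K)^{σ=−1}/(1−σ)W(K)`
— a `2`-torsion quotient of the odd group `W^{(d_K)}(ℚ)` — VANISHES: **the restriction `Ш(W/ℚ) → Ш(W_K)` is injective** (at every prime; at `p` odd
the tree already splits `Ш(W_K)[p^n]` as curve × twist, `natCard_sha_torsionBy_pow_baseChange_quadratic_of_odd`, and says «at `p = 2` nothing is
claimed»).  Hence the cell's OWN datum injects: `#Sel₂(W) = 2·#Ш(W)[2] ∣ 2·#Ш(W_K)[2^∞]` (stub RIG).  Two consequences, both kernel-checked below: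
* FORCED CO-DEPTH (`coDepth_le_of_upper_of_rig`): DIV|Ш + RIG ⟹ `#Sel₂(W)·4^{t} ≤ 2·4^{M₀}`, i.e. `M₀ − t ≥ (s−1)/2 ≥ 1` — on the Ш-cell
  the basic Heegner point `P(1)` is ALWAYS `2`-divisible past the Tamagawa–Manin shift: the depth-`0` / unit-`L`-value regime (Kriz–Li (★), the
  `M₀ = 0` locus where LINE 23's NDIV′ is automatic) is EMPTY here.  This prices the cell honestly: no (★)-type certificate can ever reach it.
* A TIGHT FRAME CLOSES FROM THE UPPER HALF ALONE (`core_eq_of_upper_of_rig_of_tight`): where `2·4^{M₀} ≤ S·4^{t}` for a proven lower bound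
  `S ∣ 2·#Ш(W_K)[2^∞]`, KEX⁰|Ш follows from DIV|Ш by antisymmetry — NO Kolyvagin non-vanishing / primitivity input, the half W. Zhang's induction
  cannot supply at `2` (Le Hung–Li 2016 Rem. 6).  v1.0 took `S = #Sel₂(W)` (RIG).  INSTRUMENT j342569 (60 frames of 30 Ш-cell curves, exact
  Heegner heights): that `W`-only count is NEVER tight — slack `≥ 2` always, and this is a THEOREM-shaped fact (parity: `dim Sel₂(W^{(d_K)})` is even,
  `s` is odd, and the two Selmer groups differ only in the local conditions at `ℓ₀ ∣ d_K` and `∞`, so either `Ш(W^{(d_K)})[2] ≠ 0` or `W[2] ⊂ W(ℚ_{ℓ₀})`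
  with Kramer's two extra classes) — but the TWO-SIDED count is tight in 60/60 frames: `2(M₀ − t) = (s−1) + v₂#Ш_an(W^{(d_K)}) + 2·𝟙[c_{ℓ₀}(W^{(d_K)}) = 4]`
  EXACTLY, every row.  Hence stub RIG⁺ (`TwinSplitInjectsShaCellAtTwo`; v1.1 prime `|d_K|`, v1.2 every odd frame): `S⁺ = #Sel₂(W)·#Ш(W^{(d_K)})[2^∞]·4^{kramerCount}`,
  with `#Ш(W^{(d_K)})[2^∞]` on the KNOWN side (BSD₂ of the rank-`0` twin is WALL row 1) and `kramerCount = ⌊Σ_{ℓ∣d_K} i_ℓ(W)/2⌋`,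
  `i_ℓ = dim W(ℚ_ℓ)[2]` (Mathlib-typed via the `2`-division cubic mod `ℓ`).  Only the SLACK frames — by j342672 exactly «`Ш(W)` has elements of
  order `4`» (76784e1, 139634k1: 13/13 frames slack by exactly `v₂#Ш_an(W) − (s−1) = 2`) — keep the lower-half stub NDIV|Ш-slack.
So **hSha ⟸ WALL row 1 + DIV|Ш + RIG + RIG⁺ + NDIV|Ш-slack + PRINT×6**, and (v1.3) DIV|Ш ⟸ K-ANN₁ (Kolyvagin's upper bound at `2` with ONE bit
of defect — the bit the `±`-eigenspace decomposition costs at `2`) + SQ (Cassels–Tate: `#Ш(W_K)[2^∞]` is a square, so an odd defect is refunded,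
`dvd_of_sq_of_dvd_two_mul`); composition `RankOneShaCellBSDTwo_of` (sorry-free outside the seven `stub_*`).

WHY NOVEL HERE (hub-relative).  LINE 23 v2.5 (U₂) splits KEX′ into DIV′/NDIV′ and finds NDIV′ automatic at depth `M₀ = 0`; LINE 9 (22139 children
27467–27472) runs Kolyvagin's `m_r` currency on the rank-`0` habitat; gk2-p2's Ш-cell file keeps KEX⁰|Ш whole.  None uses the injectivity of
`Ш(W/ℚ) → Ш(W_K)` forced by the odd finite twin, nor the split of the cell by «co-depth = ½ (Selmer excess of `W` + `v₂#Ш` of the twin) +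
Kramer bit», nor puts the twin's `Ш[2^∞]` (known by WALL row 1) on the paying side of the LOWER half.  Literature: Gross 1991 §2 and
Kolyvagin 1990 bound `Ш(W_K)` from ABOVE by the Heegner index; the lower direction at `2` is open (W. Zhang 2014 is `p ≥ 5`); the restriction kernel
computation is Kramer 1981 §2 / Serre I.§2.6 folklore, not applied to the `2`-part of the Gross–Zagier index relation in print (searches in the card).

INSTRUMENT (kit job j342569 `l41-rig1`, card § Instrument): 30 Ш-cell optimal curves `26743b1 … 53486a1` (rank `1`, odd torsion, `Ш_an = 4`,
`s = 3`), 60 prime frames `d_K = −ℓ₀`, `ℓ₀ ≡ 7 (8)`, Heegner, `r_an(W^{(d_K)}) = 0`; exact depth from the Gross–Zagier height (calibrated on `37a1`,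
`43a1` against the exact Heegner point).  Verdicts: KILL 0/60 · W-only TIGHT 0/60 · two-sided TIGHT 60/60.  A future KILL row (`2(M₀−t) < s−1`, or
`< (s−1) + v₂#Ш_an(W^{(d_K)}) + 2·kramerCount` on any frame) refutes DIV|Ш-as-typed or RIG / RIG⁺.

v1.6 — THE EXPONENT EXPLAINED (no new stub).  (i) PAR (`LocalTwoTorsionParity`, elementary): on an odd Heegner frame
`Σ_{ℓ∣d_K} i_ℓ(W) ≡ 𝟙[Δ_W < 0] (mod 2)` — a cubic has exactly one root mod `ℓ` iff its discriminant is a non-residue, every prime of `Δ_W`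
divides `N` and splits in `K`, and `|d_K| ≡ 3 (4)`, so `∏_{ℓ∣d_K} (Δ_W/ℓ) = sign Δ_W` by reciprocity; CHECKED 171/171 on the instrument frames
(88 with `Δ_W > 0`, 83 with `Δ_W < 0`).  Hence `2·kramerCount = Σ_{ℓ∣d_K} i_ℓ + 𝟙[Δ_W > 0] − 1 = (Σ_v i_v) − rank W(K)`: the exponent of RIG⁺ is
the sum of ALL of Kramer's local norm indices (`i_ℓ` at the ramified primes, `#π₀(W(ℝ)) − 1 = 𝟙[Δ_W > 0]` at `∞`, `0` at the split bad primes and at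
the unramified good prime `2`) minus `rank W(K) = 1` — the shape of [Kramer1981, Thm. 1] (`kramer_exponent_arith`).  (ii) ISO₂
(`ShaQuadraticBookkeepingAtTwo`, print-grade): for FINITE `Ш(W_K)[2^∞]`, `#Ш(W_K)[2^∞] = #Ш(W)[2^∞]·#Ш(W^{(d_K)})[2^∞]·2^{Σ_v i_v − 1}` — the
`2`-part of the Tate–Milne invariance of the BSD quotient under the isogeny `W × W^{(d_K)} → Res_{K/ℚ} W_K` (kernel `W[2]`) and Weil restriction
([Milne1972ArithmeticAV] §1 Thm. 1; Tate 1966 / Milne ADT I.7.3), made explicit at `2` on these frames (twist Tamagawa `2^{Σ i_ℓ}`, period bit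
`𝟙[Δ_W > 0]`, regulator bit `−1`).  RIG⁺ ⟸ ISO₂ + the descent count `#Sel₂(W) = 2·#Ш(W)[2]` + `#Ш(W)[2] ∣ #Ш(W)[2^∞]` (`rigPlus_arith_of_bookkeeping`),
and the SLACK of the cell is then literally `[Ш(W)[2^∞] : Ш(W)[2]]` — the order-`4` locus the instruments found.  Re-reading of the instruments: what
the 171 frames certify is the `2`-adic normalisation of the Gross–Zagier index identity `4^{M₀} = 4^{t}·#Ш_an(W)·#Ш_an(W^{(d_K)})·2^{Σ_v i_v − 1}`
(Manin constant `1`, `u_K = 1`) — the analytic bookkeeping GK2's KEX currency rests on — not a statement about `Ш(W_K)` itself.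

References: [GrossLMS1991] §2, §5 Prop. 5.3; [Kolyvagin1990Euler] Thm. A; [Kramer1981] §2 Prop. 1, Thm. 1; [GrossZagier1986] V.§2 (2.2);
[Milne1972ArithmeticAV] §1 Thm. 1; [FriedbergHoffstein1995] Thm. B; arXiv:1501.01344 (Le Hung–Li) Rem. 6; [Zhang2014] Thm. 1.1 (`p ≥ 5`).
-/

set_option linter.dupNamespace false -- `Summit.<P>.<Sub>` repeats `BirchSwinnertonDyer` (D-0017)

namespace Summit.BirchSwinnertonDyer.BirchSwinnertonDyer.Cruxes.RankOneShaCellBSDTwo.RestrictionRigidity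

open scoped Classical NumberField

open Summit.BirchSwinnertonDyer.BirchSwinnertonDyer.Theses.GenusKolyvaginAtTwo
open WeierstrassCurve NumberField Literature.NumberTheory.EllipticCurves Literature.NumberTheory.EllipticCurves.ModularForms
open Summit.BirchSwinnertonDyer.BirchSwinnertonDyer.Theorems
open Summit.BirchSwinnertonDyer.BirchSwinnertonDyer.Theorems.GenusExact.Census.ShaCell
  (shaCell_of_wall_of_friedbergHoffstein_of_kex0Sha_of_facts kex0Sha_of_shaCell_of_wall_of_facts)
open Summit.BirchSwinnertonDyer.BirchSwinnertonDyer.Theorems.GenusExact.TwinSwap.Ledger.Line25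
  (not_isOfFinAddOrder_derivedPoint_one_of_rankOne_of_lValue_ne_zero)
open Summit.BirchSwinnertonDyer.BirchSwinnertonDyer.Theorems.KolyvaginAtTwo (exists_exactTwoDepth)
open Summit.BirchSwinnertonDyer.BirchSwinnertonDyer.Theorems.GenusExact.TwinSwap.AnalyticTwin.NoTwoTorsion.Census
  (forall_two_smul_eq_zero_iff_natCard_torsionBy_eq_one)
open Summit.BirchSwinnertonDyer.BirchSwinnertonDyer.Theses.ByReductionTypeAtTwo
  (GoodOrdinaryRankZeroAtTwo MultiplicativeRankZeroAtTwo SupersingularRankZeroAtTwo AdditiveRankZeroAtTwo)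

/-! ## Displayed Props -/

/-- S1′ · the ANCHOR: BSD₂ for every non-CM globally minimal curve of analytic rank `0` (= WALL row 1 of `ByReductionTypeAtTwo`, four reduction types). -/
def RankZeroBSDTwo : Prop :=
  ∀ (W : WeierstrassCurve ℚ) [W.IsElliptic] [W.IsGloballyMinimal], ¬ W.HasCM → W.analyticRank = 0 →
    Literature.NumberTheory.EllipticCurves.BSDp W 2

/-- KEX⁰|Ш (LEAD g32, p801119's hypothesis `hKEX0Sha`, VERBATIM): the `2`-primary Gross–Zagier index relation for the Ш-cell member at every odd
Heegner frame with `2` split and `L(W^{(d_K)},1) ≠ 0`.  DERIVED below from DIV|Ш + RIG + NDIV|Ш-slack; displayed because the engine consumes this text. -/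
def HeegnerIndexRelationShaCellAtTwo : Prop :=
  ∀ (W : WeierstrassCurve ℚ) [W.IsElliptic] [W.IsGloballyMinimal] [NeZero (W.conductorNorm ℤ)],
    ¬ W.HasCM → W.analyticRank = 1 → (∀ P : W.toAffine.Point, 2 • P = 0 → P = 0) → Nat.card (W.selmerGroup 2) ≠ 2 →
    ∀ (K : Type) [Field K] [NumberField K], IsImaginaryQuadratic K →
      Odd (NumberField.discr K) → NumberField.discr K ≠ -3 → SatisfiesHeegnerHypothesis (W.conductorNorm ℤ) K →
      ((Ideal.span {(2 : ℤ)}).primesOver (𝓞 K)).ncard = 2 →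
      ∀ (Wd : WeierstrassCurve ℚ) [Wd.IsElliptic] [Wd.IsGloballyMinimal],
        (∃ C : VariableChange ℚ, C • W.quadraticTwist (NumberField.discr K : ℚ) = Wd) →
      (W.quadraticTwist (NumberField.discr K : ℚ)).entireLFunction 1 ≠ 0 →
      ∀ (Dt : ModularParametrizationData W (W.conductorNorm ℤ)) (β : ℤ) (ι : K →+* ℂ) (d₁ : KolyvaginHeegnerData Dt β ι 1),
        ∃ M₀ : ℕ,
          (∃ Q : (W.baseChange (ringClassField K ι 1)).toAffine.Point, ((2 ^ M₀ : ℕ) : ℤ) • Q = d₁.derivedPoint) ∧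
          (¬ ∃ Q : (W.baseChange (ringClassField K ι 1)).toAffine.Point, ((2 ^ (M₀ + 1) : ℕ) : ℤ) • Q = d₁.derivedPoint) ∧
          Nat.card (AddCommGroup.primaryComponent (W.baseChange K).sha 2) *
              2 ^ (2 * (padicValInt 2 Dt.c + padicValNat 2 W.tamagawaProduct)) = 2 ^ (2 * M₀)

/-- DIV|Ш · THE UPPER HALF on the Ш-cell (product-form Kolyvagin–Gross–Jetchev bound at `2` for the rank-one member, NO `2`-adic image hypothesis):
at every frame of KEX⁰|Ш and EVERY exact `2`-depth `M₀` of `P(1)`: **`#Ш(W_K)[2^∞] · 4^{ord₂ c + ord₂ C(W)} ∣ 4^{M₀}`**.  Beyond print at `2`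
(Kolyvagin 1990 / Gross 1991 §5 give `#Ш(W_K)[p^∞] ∣ p^{2M₀}` for `p` odd outside the image-deficient set; Jetchev 2008 adds `m_max` for odd `p`). -/
def HeegnerIndexUpperShaCellAtTwo : Prop :=
  ∀ (W : WeierstrassCurve ℚ) [W.IsElliptic] [W.IsGloballyMinimal] [NeZero (W.conductorNorm ℤ)],
    ¬ W.HasCM → W.analyticRank = 1 → (∀ P : W.toAffine.Point, 2 • P = 0 → P = 0) → Nat.card (W.selmerGroup 2) ≠ 2 →
    ∀ (K : Type) [Field K] [NumberField K], IsImaginaryQuadratic K →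
      Odd (NumberField.discr K) → NumberField.discr K ≠ -3 → SatisfiesHeegnerHypothesis (W.conductorNorm ℤ) K →
      ((Ideal.span {(2 : ℤ)}).primesOver (𝓞 K)).ncard = 2 →
      ∀ (Wd : WeierstrassCurve ℚ) [Wd.IsElliptic] [Wd.IsGloballyMinimal],
        (∃ C : VariableChange ℚ, C • W.quadraticTwist (NumberField.discr K : ℚ) = Wd) →
      (W.quadraticTwist (NumberField.discr K : ℚ)).entireLFunction 1 ≠ 0 →
      ∀ (Dt : ModularParametrizationData W (W.conductorNorm ℤ)) (β : ℤ) (ι : K →+* ℂ) (d₁ : KolyvaginHeegnerData Dt β ι 1) (M₀ : ℕ),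
        (∃ Q : (W.baseChange (ringClassField K ι 1)).toAffine.Point, ((2 ^ M₀ : ℕ) : ℤ) • Q = d₁.derivedPoint) →
        (¬ ∃ Q : (W.baseChange (ringClassField K ι 1)).toAffine.Point, ((2 ^ (M₀ + 1) : ℕ) : ℤ) • Q = d₁.derivedPoint) →
          Nat.card (AddCommGroup.primaryComponent (W.baseChange K).sha 2) *
              2 ^ (2 * (padicValInt 2 Dt.c + padicValNat 2 W.tamagawaProduct)) ∣ 2 ^ (2 * M₀)

/-- K-ANN₁ · KOLYVAGIN'S UPPER BOUND AT `2` WITH ONE BIT OF DEFECT (v1.3): at every frame and exact depth,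
**`#Ш(W_K)[2^∞] · 4^{ord₂ c + ord₂ C(W)} ∣ 2 · 4^{M₀}`** — DIV|Ш weakened by exactly one bit.  Why this is the natural print-facing form: at `p = 2`
the `Gal(K/ℚ)`-eigenspace decomposition `H = H⁺ ⊕ H⁻` of Kolyvagin–Gross (Gross 1991 §5 «since `p` is odd») degrades to `2H ⊂ H⁺ + H⁻`, which
costs ONE power of `2` in the annihilation exponent; every further slack must be even to survive SQ below.  Research (beyond print at `2`; strictly
weaker than DIV|Ш). [cite: GrossLMS1991, §5 Prop. 5.3] [cite: Kolyvagin1990Euler, Thm. A] [cite: McCallumLMS1991, §5] -/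
def HeegnerIndexUpperOneBitShaCellAtTwo : Prop :=
  ∀ (W : WeierstrassCurve ℚ) [W.IsElliptic] [W.IsGloballyMinimal] [NeZero (W.conductorNorm ℤ)],
    ¬ W.HasCM → W.analyticRank = 1 → (∀ P : W.toAffine.Point, 2 • P = 0 → P = 0) → Nat.card (W.selmerGroup 2) ≠ 2 →
    ∀ (K : Type) [Field K] [NumberField K], IsImaginaryQuadratic K →
      Odd (NumberField.discr K) → NumberField.discr K ≠ -3 → SatisfiesHeegnerHypothesis (W.conductorNorm ℤ) K →
      ((Ideal.span {(2 : ℤ)}).primesOver (𝓞 K)).ncard = 2 →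
      ∀ (Wd : WeierstrassCurve ℚ) [Wd.IsElliptic] [Wd.IsGloballyMinimal],
        (∃ C : VariableChange ℚ, C • W.quadraticTwist (NumberField.discr K : ℚ) = Wd) →
      (W.quadraticTwist (NumberField.discr K : ℚ)).entireLFunction 1 ≠ 0 →
      ∀ (Dt : ModularParametrizationData W (W.conductorNorm ℤ)) (β : ℤ) (ι : K →+* ℂ) (d₁ : KolyvaginHeegnerData Dt β ι 1) (M₀ : ℕ),
        (∃ Q : (W.baseChange (ringClassField K ι 1)).toAffine.Point, ((2 ^ M₀ : ℕ) : ℤ) • Q = d₁.derivedPoint) →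
        (¬ ∃ Q : (W.baseChange (ringClassField K ι 1)).toAffine.Point, ((2 ^ (M₀ + 1) : ℕ) : ℤ) • Q = d₁.derivedPoint) →
          Nat.card (AddCommGroup.primaryComponent (W.baseChange K).sha 2) *
              2 ^ (2 * (padicValInt 2 Dt.c + padicValNat 2 W.tamagawaProduct)) ∣ 2 * 2 ^ (2 * M₀)

/-- SQ · CASSELS–TATE SQUARENESS of the `2`-primary part (v1.3): for every elliptic curve over a number field, `#Ш(E/K)[2^∞]` is a perfect square
(`Nat.card = 0` when infinite, trivially a square).  In print: the Cassels–Tate pairing is alternating and non-degenerate on `Ш[2^∞]/div`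
[MilneADT2006 I Thm. 6.13, Cor. 6.24]; the tree has the finite-`Ш` form `exists_casselsTate_pairing → IsSquare (Nat.card W.sha)` (`BSDShaProofs`)
and the levelwise square index (`CasselsTatePairingSelmerTwo`).  M/L from those. -/
def ShaTwoPrimarySquare : Prop :=
  ∀ (K : Type) [Field K] [NumberField K] (E : WeierstrassCurve K) [E.IsElliptic], IsSquare (Nat.card (AddCommGroup.primaryComponent E.sha 2))

/-- RIG · RESTRICTION RIGIDITY (the lever): on a Ш-cell frame — `r_an(W) = 1`, `W(ℚ)[2] = 0`, `K` imaginary quadratic Heegner with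
`L(W^{(d_K)},1) ≠ 0`, a globally minimal model `Wd` of the twin displayed — the `2`-Selmer datum of `W` injects into `Ш(W_K)[2^∞]`:
**`#Sel₂(W) ∣ 2 · #Ш(W_K)[2^∞]`**.  Mechanism: `#Sel₂(W) = 2·#Ш(W/ℚ)[2]` (rank one, Gross–Zagier–Kolyvagin; no `2`-torsion) and
`Ш(W/ℚ) ↪ Ш(W_K)` (`Literature.NumberTheory.EllipticCurves.shaRestriction W K`) is INJECTIVE because the inflation kernel `H¹(Gal(K/ℚ), W(K))` is a
`2`-torsion quotient of `W(K)^{σ=−1} ≅ W^{(d_K)}(ℚ)`, finite of odd order.  (If `Ш(W_K)[2^∞]` were infinite the right side is `0` and the clause is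
void — DIV|Ш excludes that case.)  Not in the tree at `2` (the tree's quadratic splittings of `Ш` are for odd `p` only); PROVABLE from print. -/
def SelmerExcessInjectsShaCellAtTwo : Prop :=
  ∀ (W : WeierstrassCurve ℚ) [W.IsElliptic] [W.IsGloballyMinimal] [NeZero (W.conductorNorm ℤ)],
    ¬ W.HasCM → W.analyticRank = 1 → (∀ P : W.toAffine.Point, 2 • P = 0 → P = 0) → Nat.card (W.selmerGroup 2) ≠ 2 →
    ∀ (K : Type) [Field K] [NumberField K], IsImaginaryQuadratic K →
      Odd (NumberField.discr K) → NumberField.discr K ≠ -3 → SatisfiesHeegnerHypothesis (W.conductorNorm ℤ) K →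
      ((Ideal.span {(2 : ℤ)}).primesOver (𝓞 K)).ncard = 2 →
      ∀ (Wd : WeierstrassCurve ℚ) [Wd.IsElliptic] [Wd.IsGloballyMinimal],
        (∃ C : VariableChange ℚ, C • W.quadraticTwist (NumberField.discr K : ℚ) = Wd) →
      (W.quadraticTwist (NumberField.discr K : ℚ)).entireLFunction 1 ≠ 0 →
        Nat.card (W.selmerGroup 2) ∣ 2 * Nat.card (AddCommGroup.primaryComponent (W.baseChange K).sha 2)

/-- The LOCAL `2`-TORSION DIMENSION `i_ℓ(W) := dim_{𝔽₂} W(ℚ_ℓ)[2]` at an odd prime `ℓ` of good reduction, read off the minimal model: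
`log₂ (1 + #roots of the 2-division cubic mod ℓ)` ∈ {0, 1, 2} (#roots ∈ {0, 1, 3}).  For `ℓ ∣ d_K` prime to `N` this is Kramer's local norm index
`δ_ℓ(W, K/ℚ) = dim W(ℚ_ℓ)/N W(K_λ)` and `c_ℓ(W^{(d_K)}) = 2^{i_ℓ}` [Kramer1981, Prop. 3; MazurRubin2010 Lemma 2.9].  Sibling of LINE 39/40's
`FrobTransvectionAt` (`i_ℓ = 1`).  Mathlib-only (`Nat.card` of the root set; no primality instance needed; junk at non-primes is harmless: only
`ℓ ∈ primeFactors` is ever used). -/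
noncomputable def localTwoTorsionDim (W : WeierstrassCurve ℚ) [W.IsGloballyMinimal] (ℓ : ℕ) : ℕ :=
  Nat.log 2 (Nat.card {x : ZMod ℓ // (WeierstrassCurve.twoTorsionPolynomial
    ((WeierstrassCurve.integralModelInt W).map (Int.castRingHom (ZMod ℓ)))).toPoly.eval x = 0} + 1)

/-- The KRAMER COUNT of a frame (v1.4, dictated by instruments j342569 + j342672, 128/128 frames): **`⌊(Σ_{ℓ ∣ d_K} i_ℓ(W)) / 2⌋`** — the `2`-adic
defect of `Ш` under `ℚ → K` on a Ш-cell frame is exactly `4^{kramerCount}`: each ramified prime contributes its local norm index `i_ℓ`, and an odd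
total loses one unit (the generator's global norm obstruction, Kramer's `Φ`-term).  v1.1 used `𝟙[c_{ℓ₀}(W^{(d_K)}) = 4]` on prime frames, v1.2
`#{ℓ : i_ℓ = 2}`; j342672's composite frames with two `i_ℓ = 1` primes (5/5 of them off by exactly `4`) forced this form. -/
noncomputable def kramerCount (W : WeierstrassCurve ℚ) [W.IsGloballyMinimal] (K : Type) [Field K] [NumberField K] : ℕ :=
  (Finset.sum (NumberField.discr K).natAbs.primeFactors (fun ℓ => localTwoTorsionDim W ℓ)) / 2

/-- RIG⁺ · TWO-SIDED `2`-DESCENT RIGIDITY (v1.4: every odd Heegner frame, `kramerCount = ⌊Σ_{ℓ∣d_K} i_ℓ/2⌋`; v1.1 had `|d_K|` prime): on a Ш-cell frame, BOTH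
restriction maps contribute — `Ш(W/ℚ)[2] ↪ Ш(W_K)` (kernel `H¹(K/ℚ, W(K)) = 0`, twin finite odd), `Ш(W^{(d_K)}/ℚ)[2^∞] → Ш(W_K)[2^∞]` (kernel
`≤ H¹(K/ℚ, W^{(d_K)}(K)) ≅ W(ℚ)/2 ≅ ℤ/2`, recovered by Cassels–Tate squareness), plus Kramer's local norm classes at the ramified primes
(`4^{kramerCount}`, `kramerCount = ⌊Σ i_ℓ / 2⌋`): **`#Sel₂(W) · #Ш(W^{(d_K)})[2^∞] · 4^{kramerCount} ∣ 2 · #Ш(W_K)[2^∞]`**.  Measured law (60/60 frames, `Ш_an(W) = 4`): EQUALITY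
`v₂#Ш(W_K)[2^∞] = v₂#Ш(W)[2^∞] + v₂#Ш_an(W^{(d_K)}) + 2·kramerCount` (128/128 frames; `= (s−1) + …` exactly when `Ш(W)[4] = Ш(W)[2]`).  Galois cohomology + local norm indices [Kramer1981 Thms. 1–2]; at `2` not in the
tree (odd-`p` splittings only); size L.  Void if `Ш(W_K)[2^∞]` is infinite (`Nat.card = 0`). -/
def TwinSplitInjectsShaCellAtTwo : Prop :=
  ∀ (W : WeierstrassCurve ℚ) [W.IsElliptic] [W.IsGloballyMinimal] [NeZero (W.conductorNorm ℤ)],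
    ¬ W.HasCM → W.analyticRank = 1 → (∀ P : W.toAffine.Point, 2 • P = 0 → P = 0) → Nat.card (W.selmerGroup 2) ≠ 2 →
    ∀ (K : Type) [Field K] [NumberField K], IsImaginaryQuadratic K →
      Odd (NumberField.discr K) → NumberField.discr K ≠ -3 → SatisfiesHeegnerHypothesis (W.conductorNorm ℤ) K →
      ((Ideal.span {(2 : ℤ)}).primesOver (𝓞 K)).ncard = 2 →
      ∀ (Wd : WeierstrassCurve ℚ) [Wd.IsElliptic] [Wd.IsGloballyMinimal],
        (∃ C : VariableChange ℚ, C • W.quadraticTwist (NumberField.discr K : ℚ) = Wd) →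
      (W.quadraticTwist (NumberField.discr K : ℚ)).entireLFunction 1 ≠ 0 →
        Nat.card (W.selmerGroup 2) * Nat.card (AddCommGroup.primaryComponent Wd.sha 2) * 2 ^ (2 * kramerCount W K) ∣
          2 * Nat.card (AddCommGroup.primaryComponent (W.baseChange K).sha 2)

/-- PAR · LOCAL TWO-TORSION PARITY (v1.6; elementary, provable: «a separable cubic over `𝔽_ℓ` has exactly one root iff its discriminant is a
non-square», every prime of `Δ_W` divides `N` hence splits in `K`, `|d_K| ≡ 3 (mod 4)`, quadratic reciprocity ⟹ `∏_{ℓ∣d_K} (Δ_W/ℓ) = sign Δ_W`);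
validated 171/171 on the instrument frames of j342569/j342672/j342713.  It identifies `2·kramerCount W K` with
`Σ_{ℓ∣d_K} i_ℓ(W) + 𝟙[0 < Δ_W] − 1 = Σ_v i_v − rank W(K)` ([Kramer1981] Thm. 1 shape; `kramer_exponent_arith`). [cite: Kramer1981, §2 Prop. 1, Thm. 1] -/
def LocalTwoTorsionParity : Prop :=
  ∀ (W : WeierstrassCurve ℚ) [W.IsElliptic] [W.IsGloballyMinimal] [NeZero (W.conductorNorm ℤ)],
    (∀ P : W.toAffine.Point, 2 • P = 0 → P = 0) →
    ∀ (K : Type) [Field K] [NumberField K], IsImaginaryQuadratic K → Odd (NumberField.discr K) →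
      SatisfiesHeegnerHypothesis (W.conductorNorm ℤ) K →
        (Finset.sum (NumberField.discr K).natAbs.primeFactors (fun ℓ => localTwoTorsionDim W ℓ)) % 2 = if W.Δ < 0 then 1 else 0

/-- ISO₂ · QUADRATIC BASE-CHANGE BOOKKEEPING AT `2` (v1.6 — the print-grade form behind RIG⁺): on a Ш-cell frame with FINITE `Ш(W_K)[2^∞]`,
**`#Ш(W_K)[2^∞] = #Ш(W)[2^∞] · #Ш(W^{(d_K)})[2^∞] · 2^{Σ_{ℓ∣d_K} i_ℓ(W) + 𝟙[0 < Δ_W] − 1}`** — the `2`-primary part of the invariance of the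
Birch–Swinnerton-Dyer quotient under the isogeny `W × W^{(d_K)} → Res_{K/ℚ} W_K` (kernel `≅ W[2]`) and under Weil restriction, with the local terms
made explicit on these frames: Tamagawa `c_ℓ(W^{(d_K)}) = 2^{i_ℓ}` at `ℓ ∣ d_K` (type `I₀*`), `1` at the split bad primes and at `2 ∤ d_K`; period
bit `#π₀(W(ℝ)) − 1 = 𝟙[0 < Δ_W]`; regulator bit `−rank W(K) = −1` (`W(K) ⊇ W(ℚ) ⊕ W^{(d_K)}(ℚ)` of odd index since `W(K)[2] = 0`).  Modulo the two PRINT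
rank facts.  With PAR the exponent is `2·kramerCount W K`; RIG⁺ follows (`rigPlus_arith_of_bookkeeping`).  Size L (the tree has the BSD-quotient
pieces for `BSDp`; the isogeny-invariance theorem at `2` is print, not yet in the tree).
Print template: Dokchitser–Dokchitser 2010 (Ann. of Math. 172) Thm. 4.3 — the UNCONDITIONAL Selmer-group form of Tate–Milne isogeny invariance
(`Ш` mod divisible part, defect `Q(φ)`), with Thm. 2.3 / Milne 1972 §1 for `BSD_p(Res_{K/ℚ} W_K) = BSD_p(W/K)` and §4.2 for the isogeny
`W × W^{(d)} → Res_{K/ℚ} W_K`; under `Finite Ш(W_K)[2^∞]` the divisible parts vanish and `Q` is the Mordell–Weil cokernel (odd here).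
TREE INPUTS (v1.6.1 — the fact is ALREADY VENDORED): `Literature.NumberTheory.EllipticCurves.Milne1972.bsdQuotientP_baseChange_relQuadratic_anyModel`
(D–D Thm. 2.3 `p`-part, any number-field base incl. `ℚ`, any models, EVERY prime incl. `2`; instantiate `K := ℚ`, `M := K`, `p := 2`, `V := W`,
`Vβ := Wd`, `VM := W.baseChange K`; it wants `Finite Ш(W)[2^∞]` — from RIG's injection `Ш(W)[2^∞] ↪ Ш(W_K)[2^∞]` (LEAD's
`shaRestriction_injective_of_noTwoTorsion_of_twist_rank_zero`) and the finiteness here — and `Finite Ш(Wd)[2^∞]` — from WALL row 1) + FOUR 2-adic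
bookkeeping lemmas on Heegner frames: regulator `Reg(W_K) = 2·Reg(W)·(odd index)²` (heights over `K` double; `W(K) ⊇ W(ℚ) ⊕ W^{(d_K)}(ℚ)` odd index),
period `ord₂ (Ω(W)·Ω(Wd)·|d_K|^{1/2} / bsdPeriod(W_K)) = 𝟙[0 < Δ_W]`, Tamagawa `ord₂ (C(W)·C(Wd)/C(W_K)) = Σ_{ℓ∣d_K} i_ℓ` (`c_ℓ(Wd) = 1 + #roots`, type
`I₀*`; split bad primes cancel), torsion odd — then PAR turns the exponent into `2·kramerCount`.  Cf. the tree's odd-`p` analogue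
`card_primaryComponent_sha_baseChange_quadratic_of_odd` (`BSDQuadraticDescentShaOddPartProofs.lean`, exponent `0`).
[cite: DokchitserDokchitser2010Annals, Thm. 4.3, Thm. 2.3, §4.2] [cite: Milne1972ArithmeticAV, §1 Thm. 1] [cite: MilneADT, I.7.3] [cite: Cassels1965VIII] [cite: Kramer1981, Thm. 1] -/
def ShaQuadraticBookkeepingAtTwo : Prop :=
  ∀ (W : WeierstrassCurve ℚ) [W.IsElliptic] [W.IsGloballyMinimal] [NeZero (W.conductorNorm ℤ)],
    ¬ W.HasCM → W.analyticRank = 1 → (∀ P : W.toAffine.Point, 2 • P = 0 → P = 0) →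
    ∀ (K : Type) [Field K] [NumberField K], IsImaginaryQuadratic K →
      Odd (NumberField.discr K) → NumberField.discr K ≠ -3 → SatisfiesHeegnerHypothesis (W.conductorNorm ℤ) K →
      ((Ideal.span {(2 : ℤ)}).primesOver (𝓞 K)).ncard = 2 →
      ∀ (Wd : WeierstrassCurve ℚ) [Wd.IsElliptic] [Wd.IsGloballyMinimal],
        (∃ C : VariableChange ℚ, C • W.quadraticTwist (NumberField.discr K : ℚ) = Wd) →
      (W.quadraticTwist (NumberField.discr K : ℚ)).entireLFunction 1 ≠ 0 →
        Finite (AddCommGroup.primaryComponent (W.baseChange K).sha 2) →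
        Nat.card (AddCommGroup.primaryComponent (W.baseChange K).sha 2) =
          Nat.card (AddCommGroup.primaryComponent W.sha 2) * Nat.card (AddCommGroup.primaryComponent Wd.sha 2) *
            2 ^ (Finset.sum (NumberField.discr K).natAbs.primeFactors (fun ℓ => localTwoTorsionDim W ℓ) + (if 0 < W.Δ then 1 else 0) - 1)

/-- NDIV|Ш-slack · THE LOWER HALF ON THE SLACK FRAMES ONLY: at a frame of KEX⁰|Ш and an exact `2`-depth `M₀` of `P(1)` with
`#Sel₂(W) · 4^{ord₂ c + ord₂ C(W)} < 2 · 4^{M₀}` (the Heegner co-depth EXCEEDS half the `2`-Selmer excess): **`4^{M₀} ∣ #Ш(W_K)[2^∞] · 4^{ord₂ c + ord₂ C(W)}`**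
— the extra `2`-divisibility of `y_K` is paid by order-`4` elements of `Ш(W)`, by `Ш(W^{(d_K)})[2^∞]`, or by Kramer's local norm defect at the primes of
`d_K`.  Beyond print at `2` (Kolyvagin non-vanishing / W. Zhang's induction is `p ≥ 5`; obstructed at `2`, Le Hung–Li 2016 Rem. 6); VOID on the tight
locus and (v1.2) on every frame tight for the two-sided count of RIG⁺ (`2·4^{M₀} ≤ #Sel₂(W)·#Ш(W^{(d_K)})[2^∞]·4^{kramerCount}·4^{t}`) — by
instrument j342569 that is 60/60 of the sampled prime frames; what is left is conjecturally the locus «`Ш(W)` has elements of order `4`». -/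
def HeegnerIndexLowerSlackShaCellAtTwo : Prop :=
  ∀ (W : WeierstrassCurve ℚ) [W.IsElliptic] [W.IsGloballyMinimal] [NeZero (W.conductorNorm ℤ)],
    ¬ W.HasCM → W.analyticRank = 1 → (∀ P : W.toAffine.Point, 2 • P = 0 → P = 0) → Nat.card (W.selmerGroup 2) ≠ 2 →
    ∀ (K : Type) [Field K] [NumberField K], IsImaginaryQuadratic K →
      Odd (NumberField.discr K) → NumberField.discr K ≠ -3 → SatisfiesHeegnerHypothesis (W.conductorNorm ℤ) K →
      ((Ideal.span {(2 : ℤ)}).primesOver (𝓞 K)).ncard = 2 →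
      ∀ (Wd : WeierstrassCurve ℚ) [Wd.IsElliptic] [Wd.IsGloballyMinimal],
        (∃ C : VariableChange ℚ, C • W.quadraticTwist (NumberField.discr K : ℚ) = Wd) →
      (W.quadraticTwist (NumberField.discr K : ℚ)).entireLFunction 1 ≠ 0 →
      ∀ (Dt : ModularParametrizationData W (W.conductorNorm ℤ)) (β : ℤ) (ι : K →+* ℂ) (d₁ : KolyvaginHeegnerData Dt β ι 1) (M₀ : ℕ),
        (∃ Q : (W.baseChange (ringClassField K ι 1)).toAffine.Point, ((2 ^ M₀ : ℕ) : ℤ) • Q = d₁.derivedPoint) →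
        (¬ ∃ Q : (W.baseChange (ringClassField K ι 1)).toAffine.Point, ((2 ^ (M₀ + 1) : ℕ) : ℤ) • Q = d₁.derivedPoint) →
        Nat.card (W.selmerGroup 2) * 2 ^ (2 * (padicValInt 2 Dt.c + padicValNat 2 W.tamagawaProduct)) < 2 * 2 ^ (2 * M₀) →
        Nat.card (W.selmerGroup 2) * Nat.card (AddCommGroup.primaryComponent Wd.sha 2) * 2 ^ (2 * kramerCount W K) *
            2 ^ (2 * (padicValInt 2 Dt.c + padicValNat 2 W.tamagawaProduct)) < 2 * 2 ^ (2 * M₀) →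
          2 ^ (2 * M₀) ∣ Nat.card (AddCommGroup.primaryComponent (W.baseChange K).sha 2) *
              2 ^ (2 * (padicValInt 2 Dt.c + padicValNat 2 W.tamagawaProduct))

/-! ## The seven stubs -/

/-- stub WALL = items `GoodOrdinaryRankZeroAtTwo` (19095), `MultiplicativeRankZeroAtTwo` (19096), `SupersingularRankZeroAtTwo` (19097),
`AdditiveRankZeroAtTwo` (19098) of route `ByReductionTypeAtTwo` BY NAME (WALL row 1; the four support binders of GK2's `closes`). -/
theorem stub_wallRankZeroAtTwo :
    GoodOrdinaryRankZeroAtTwo ∧ MultiplicativeRankZeroAtTwo ∧ SupersingularRankZeroAtTwo ∧ AdditiveRankZeroAtTwo := by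
  sorry

/-- stub K-ANN₁ — Kolyvagin's upper bound at `2` with one bit of defect (research; beyond print at `2`; DIV|Ш minus one bit). -/
theorem stub_heegnerIndexUpperOneBit : HeegnerIndexUpperOneBitShaCellAtTwo := by
  sorry

/-- stub SQ — Cassels–Tate squareness of `#Ш[2^∞]`.  **v1.8: CLOSED BY NAME, OUTRIGHT** — LEAD bsd-line-gk2-p1 g32's p810985
`…ShaCell.ShaSquare.shaTwoPrimarySquare_of_casselsTate : (∀ K, exists_casselsTate_pairing (K := K)) → <SQ text verbatim>` fed with the TREE THEOREM
`WeierstrassCurve.exists_casselsTate_pairing_holds {K : Type}` (Cassels–Tate for every number field, `Theorems.GenusKolyvaginAtTwoCasselsTatePairingRat`,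
LEAD gk2-p1 g13 via gk2-p2 g13's `exists_casselsTate_pairing_of_levelThetaDatum` + `levelThetaDatumEven`); probe `bc/ct_probe.lean` rc 0 · 0 err · 0 sorry.
(RIDER R-LEAD-41b proposed the binder form «CT ⟹ SQ»; the binder is discharged in the tree, so no PRINT conjunct is added.) -/
theorem stub_shaTwoPrimarySquare : ShaTwoPrimarySquare :=
  Summit.BirchSwinnertonDyer.BirchSwinnertonDyer.Theorems.GenusExact.ShaCell.ShaSquare.shaTwoPrimarySquare_of_casselsTate
    (fun K _ _ => WeierstrassCurve.exists_casselsTate_pairing_holds (K := K))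

/-- stub RIG — restriction rigidity `#Sel₂(W) ∣ 2·#Ш(W_K)[2^∞]` on a Ш-cell frame, **modulo the two PRINT facts it really uses** (v1.5, LEAD gk2-p1's RIDER
R-LEAD-41a: the descent count `#Sel₂ = 2^{rank}·#Ш[2]` needs `rank W(ℚ) ≤ 1` and `rank W^{(d_K)}(ℚ) = 0`, i.e. GZK `MultPublishedInputsAtTwo` + modularity `EntireLFunctionRat`;
with the binders prepended the stub is closed BY NAME by LEAD's `selmerExcessInjectsShaCellAtTwo_of_facts`).  Provable from print: GZK on `Wd`, `W^{(d_K)}[2] ≅ W[2]`,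
inflation–restriction for `Gal(K/ℚ)`, the Kummer sequence `0 → W(ℚ)/2 → Sel₂(W) → Ш(W)[2] → 0`; M/L over the tree's `galH1`/`shaRestriction`. -/
theorem stub_selmerExcessInjects : MultPublishedInputsAtTwo → EntireLFunctionRat → SelmerExcessInjectsShaCellAtTwo :=
  -- v1.7: CLOSED BY NAME (rider R-LEAD-41a paid in full) — LEAD bsd-line-gk2-p1 g32's p809687, std axioms, no sorry.
  fun hGZK hmod => Summit.BirchSwinnertonDyer.BirchSwinnertonDyer.Theorems.GenusExact.ShaCell.CleanDescent.selmerExcessInjectsShaCellAtTwo_of_facts hGZK hmod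

/-- stub ISO₂ (v1.9) — quadratic base-change bookkeeping at `2` (PRINT-grade, L: Milne 1972 / isogeny invariance of the BSD quotient at `2`, tree fact
`Literature.NumberTheory.EllipticCurves.Milne1972.bsdQuotientP_baseChange_relQuadratic_anyModel` (K:=ℚ, M:=K, p:=2) + four 2-adic bookkeeping lemmas:
regulator `R(W_K) = 2·R(W)·odd²`, `R(Wd) = 1`; period bit `𝟙[0<Δ_W]`; Tamagawa `c_ℓ(Wd) = 2^{i_ℓ}` at `ℓ ∣ d_K`; odd torsion). -/
theorem stub_shaQuadraticBookkeeping : MultPublishedInputsAtTwo → MilneAnyModel → ShaQuadraticBookkeepingAtTwo :=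
  -- v2.0: CLOSED BY NAME modulo its two PRINT inputs (rider R-LEAD-41c; LEAD bsd-line-gk2-p1 g33, p819543, over the sibling cell
  -- bsd-print-cf2's `ShaCountTwo.padicValNat_two_shaOrder_baseChange_eq_of_milne_composite`)
  fun hGZK hM =>
    Summit.BirchSwinnertonDyer.BirchSwinnertonDyer.Theorems.GenusExact.ShaCell.Bookkeeping.shaQuadraticBookkeepingAtTwo_of_facts hGZK hM

/-- stub PAR (v1.9) — local two-torsion parity on odd Heegner frames (PRINT-grade, M: Stickelberger cubic + Jacobi product; birth skeleton
`bc/par_birth.lean` with 2 print stubs and a kernel-checked composition; 171/171 instrument frames). -/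
theorem stub_localTwoTorsionParity : LocalTwoTorsionParity :=
  -- v2.0: CLOSED BY NAME, OUTRIGHT (LEAD bsd-line-gk2-p1 g33, p817974; S1 Stickelberger p817665 + S2 Jacobi product)
  Summit.BirchSwinnertonDyer.BirchSwinnertonDyer.Theorems.GenusExact.ShaCell.LocalParity.localTwoTorsionParity_holds

/-! ### v1.9 · RIG⁺ WIRED (crit-5 #634 P1 paid): ISO₂ + PAR + GZK + modularity ⟹ RIG⁺, sorry-free; no WALL row needed -/

/-- ℕ-core of the wiring (same as `rigPlus_arith_of_bookkeeping` below, placed here for use order). -/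
theorem rigPlus_arith_core {C A A₂ B S κ : ℕ} (hC : C = A * B * 2 ^ (2 * κ)) (hS : S = 2 * A₂) (hA : A₂ ∣ A) :
    S * B * 2 ^ (2 * κ) ∣ 2 * C := by
  obtain ⟨q, rfl⟩ := hA
  subst hC; subst hS
  exact ⟨q, by ring⟩

/-- `Ш(W) ⊓ H¹[2]` injects into `Ш(W)[2^∞]`, so its order divides `#Ш(W)[2^∞]` (`Nat.card`; `0` when infinite). -/
theorem natCard_sha_inf_torsionBy_two_dvd_natCard_shaPrimary (W : WeierstrassCurve ℚ) [W.IsElliptic] :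
    Nat.card (W.sha ⊓ AddSubgroup.torsionBy W.galH1 (2 : ℕ) : AddSubgroup W.galH1) ∣
      Nat.card (AddCommGroup.primaryComponent W.sha 2) := by
  set H : AddSubgroup W.galH1 := W.sha ⊓ AddSubgroup.torsionBy W.galH1 (2 : ℕ) with hH
  let g : H →+ W.sha := AddSubgroup.inclusion inf_le_left
  have hg2 : ∀ c : H, (2 : ℕ) • g c = 0 := by
    intro c
    have hc2 : (2 : ℕ) • (c : W.galH1) = 0 := AddSubgroup.torsionBy.nsmul_iff.mp (AddSubgroup.mem_inf.mp c.2).2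
    apply Subtype.ext
    simp only [g, AddSubgroupClass.coe_nsmul, AddSubgroup.coe_inclusion, ZeroMemClass.coe_zero]
    exact hc2
  have hmem : ∀ c : H, g c ∈ AddCommGroup.primaryComponent W.sha 2 := fun c ↦
    AddCommGroup.mem_primaryComponent.mpr ⟨1, by rw [pow_one]; exact_mod_cast hg2 c⟩
  let φ : H →+ AddCommGroup.primaryComponent W.sha 2 := g.codRestrict _ hmem
  have hφ : Function.Injective φ := by
    intro a b hab
    have h1 : g a = g b := by
      have := congrArg Subtype.val hab
      simpa [φ] using this
    exact AddSubgroup.inclusion_injective inf_le_left h1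
  exact AddSubgroup.card_dvd_of_injective φ hφ

/-- stub PRINT = the route's print items BY NAME — `GrossZagierAllLevels` (24148), `MultPublishedInputsAtTwo` (19921 = GZK), `EntireLFunctionRat`
(19273), `MilneAnyModel` (24149) — + BCDT `nonempty_modularParametrizationData` + Friedberg–Hoffstein
`friedbergHoffstein_exists_heegnerField_split_twist_ne_zero` (Literature statement-only facts, in print). -/
theorem stub_printFacts :
    GrossZagierAllLevels ∧ MultPublishedInputsAtTwo ∧ EntireLFunctionRat ∧ MilneAnyModel ∧ nonempty_modularParametrizationData ∧
      friedbergHoffstein_exists_heegnerField_split_twist_ne_zero := by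
  sorry

/-- The exponent bookkeeping: PAR turns `Σ i_ℓ + 𝟙[0 < Δ] − 1` into `2 · kramerCount = 2 · ⌊Σ i_ℓ / 2⌋`. -/
theorem exponent_eq_two_mul_kramerCount {s : ℕ} {Δ : ℚ} (hΔ : Δ ≠ 0) (hpar : s % 2 = if Δ < 0 then 1 else 0) :
    s + (if 0 < Δ then 1 else 0) - 1 = 2 * (s / 2) := by
  rcases lt_or_gt_of_ne hΔ with h | h
  · rw [if_pos h] at hpar; rw [if_neg (not_lt.mpr h.le)]; omega
  · rw [if_neg (not_lt.mpr h.le)] at hpar; rw [if_pos h]; omega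

/-- **RIG⁺ WIRED (v1.9, sorry-free): ISO₂ + PAR + GZK + modularity ⟹ RIG⁺** (`#Sel₂(W) = 2·#(Ш(W) ⊓ H¹[2])` by the descent count at rank one with no
`2`-torsion; `#(Ш ⊓ H¹[2]) ∣ #Ш(W)[2^∞]`; ISO₂'s product formula with PAR's exponent; infinite `Ш(W_K)[2^∞]` ⟹ `Nat.card = 0` ⟹ trivial). -/
theorem twinSplitInjects_of_iso_par (hGZK : MultPublishedInputsAtTwo) (hmod : EntireLFunctionRat)
    (hISO : ShaQuadraticBookkeepingAtTwo) (hPAR : LocalTwoTorsionParity) : TwinSplitInjectsShaCellAtTwo := by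
  intro W _ _ _ hCM hr hT hSel K _ _ hK hodd h3 hH h2 Wd _ _ hWd hL
  by_cases hfin : Finite (AddCommGroup.primaryComponent (W.baseChange K).sha 2)
  · have hC := hISO W hCM hr hT K hK hodd h3 hH h2 Wd hWd hL hfin
    have hpar := hPAR W hT K hK hodd hH
    have hΔ : W.Δ ≠ 0 := W.isUnit_Δ.ne_zero
    rw [exponent_eq_two_mul_kramerCount hΔ hpar] at hC
    have h1 : W.mordellWeilRank = 1 := ((hGZK W hr.le).1).trans hr
    have hcount := card_selmerGroup_eq_pow_rank_mul W 2
    simp only [Nat.cast_ofNat] at hcount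
    have htors := (forall_two_smul_eq_zero_iff_natCard_torsionBy_eq_one W).mp (fun P hP ↦ hT P (by convert hP))
    rw [h1, pow_one, htors, mul_one] at hcount
    exact rigPlus_arith_core hC hcount (natCard_sha_inf_torsionBy_two_dvd_natCard_shaPrimary W)
  · have h0 : Nat.card (AddCommGroup.primaryComponent (W.baseChange K).sha 2) = 0 := by
      rw [not_finite_iff_infinite] at hfin
      exact Nat.card_eq_zero_of_infinite
    rw [h0, mul_zero]
    exact dvd_zero _

/-- stub RIG⁺ — **v1.9: DERIVED, no sorry of its own** (ISO₂ + PAR stubs + the two PRINT facts, via `twinSplitInjects_of_iso_par`). -/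
theorem stub_twinSplitInjects : MultPublishedInputsAtTwo → EntireLFunctionRat → TwinSplitInjectsShaCellAtTwo :=
  fun hGZK hmod => twinSplitInjects_of_iso_par hGZK hmod (stub_shaQuadraticBookkeeping hGZK stub_printFacts.2.2.2.1)
    stub_localTwoTorsionParity

/-- stub NDIV|Ш-slack — the lower half on the slack frames only (research; beyond print at `2`). -/
theorem stub_heegnerIndexLowerSlack : HeegnerIndexLowerSlackShaCellAtTwo := by
  sorry

/-! ## Closed pieces (kernel-checked, no sorry): the arithmetic of the lever, the S1′ door, KEX⁰|Ш from the three halves, losslessness -/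

/-- The SQUARENESS REFUND (ℕ-core): a square `A` with `A·4^t ∣ 2·4^{M}` already satisfies `A·4^t ∣ 4^{M}` — an odd power of `2` cannot be
the exact defect of a square. [folklore] -/
theorem dvd_of_sq_of_dvd_two_mul {A t M : ℕ} (hA : IsSquare A) (h : A * 2 ^ (2 * t) ∣ 2 * 2 ^ (2 * M)) :
    A * 2 ^ (2 * t) ∣ 2 ^ (2 * M) := by
  obtain ⟨r, rfl⟩ := hA
  rcases Nat.eq_zero_or_pos r with h0 | hr
  · subst h0; simp at h
  · -- `r*r * 4^t ∣ 2^(2M+1)` ⇒ `r * 2^t` is a power of two `2^k` with `2k ≤ 2M+1`, hence `2k ≤ 2M`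
    have h2 : (r * 2 ^ t) ^ 2 ∣ 2 ^ (2 * M + 1) := by
      have : (r * 2 ^ t) ^ 2 = r * r * 2 ^ (2 * t) := by ring
      rw [this, pow_succ, mul_comm (2 ^ (2 * M)) 2]; exact h
    obtain ⟨k, hk⟩ := (Nat.dvd_prime_pow Nat.prime_two).mp (dvd_trans (dvd_pow_self _ two_ne_zero) h2)
    have hk2 : (r * 2 ^ t) ^ 2 = 2 ^ (2 * k) := by rw [hk.2, ← pow_mul, mul_comm]
    have hle : 2 * k ≤ 2 * M + 1 := by
      have := Nat.pow_dvd_pow_iff_le_right (Nat.one_lt_two) |>.mp (hk2 ▸ h2)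
      exact this
    have hle' : 2 * k ≤ 2 * M := by omega
    have : r * r * 2 ^ (2 * t) = 2 ^ (2 * k) := by rw [← hk2]; ring
    rw [this]; exact Nat.pow_dvd_pow 2 hle'

/-- **DIV|Ш ⟸ K-ANN₁ + SQ** (v1.3): Cassels–Tate squareness refunds the bit that the `±`-decomposition costs at `2`.  CONDITIONAL. [folklore] -/
theorem heegnerIndexUpper_of_oneBit_of_square (h1 : HeegnerIndexUpperOneBitShaCellAtTwo) (hsq : ShaTwoPrimarySquare) :
    HeegnerIndexUpperShaCellAtTwo := by
  intro W _ _ _ hcm hr hT2 hSel K _ _ hK hodd h3 hH h2K Wd _ _ hWd hLv Dt β ι d₁ M₀ hdiv hndiv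
  haveI : (W.baseChange K).IsElliptic := by rw [baseChange]; infer_instance
  exact dvd_of_sq_of_dvd_two_mul (hsq K (W.baseChange K))
    (h1 W hcm hr hT2 hSel K hK hodd h3 hH h2K Wd hWd hLv Dt β ι d₁ M₀ hdiv hndiv)

/-- The numeric core of the lever.  `A = #Ш(W_K)[2^∞]`, `S = #Sel₂(W)`, `T = 4^{t}`, `P = 4^{M₀}`: the upper half `A·T ∣ P`, rigidity `S ∣ 2A` and
tightness `2P ≤ S·T` force the EQUALITY `A·T = P` — no lower-half input. [folklore] -/
theorem core_eq_of_upper_of_rig_of_tight {A S T P : ℕ} (hP : 0 < P) (hup : A * T ∣ P) (hrig : S ∣ 2 * A) (htight : 2 * P ≤ S * T) :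
    A * T = P := by
  have hA : 0 < A := by
    rcases Nat.eq_zero_or_pos A with h | h
    · exfalso; rw [h, zero_mul] at hup; exact hP.ne' (Nat.eq_zero_of_zero_dvd hup)
    · exact h
  have hS : S ≤ 2 * A := Nat.le_of_dvd (by omega) hrig
  have h1 : 2 * P ≤ 2 * (A * T) :=
    htight.trans (by calc S * T ≤ (2 * A) * T := Nat.mul_le_mul_right _ hS
                        _ = 2 * (A * T) := by ring)
  exact le_antisymm (Nat.le_of_dvd hP hup) (Nat.le_of_mul_le_mul_left h1 (by norm_num))

/-- The forced co-depth: the upper half and rigidity give `S·T ≤ 2·(A·T) ≤ 2P`, i.e. `#Sel₂(W)·4^{t} ≤ 2·4^{M₀}` — on the Ш-cell (`#Sel₂(W) ≥ 8`)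
the Heegner point is `2`-divisible strictly past the shift `t`. [folklore] -/
theorem coDepth_le_of_upper_of_rig {A S T P : ℕ} (hP : 0 < P) (hup : A * T ∣ P) (hrig : S ∣ 2 * A) : S * T ≤ 2 * P := by
  have hA : 0 < A := by
    rcases Nat.eq_zero_or_pos A with h | h
    · exfalso; rw [h, zero_mul] at hup; exact hP.ne' (Nat.eq_zero_of_zero_dvd hup)
    · exact h
  have hS : S ≤ 2 * A := Nat.le_of_dvd (by omega) hrig
  calc S * T ≤ (2 * A) * T := Nat.mul_le_mul_right _ hS
    _ = 2 * (A * T) := by ring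
    _ ≤ 2 * P := Nat.mul_le_mul_left _ (Nat.le_of_dvd hP hup)

/-- WALL row 1 (ByReductionTypeAtTwo 19095–19098) ⟹ S1′, by the reduction-type tetrachotomy at `2`. [folklore] -/
theorem rankZeroBSDTwo_of_wall (hOrd : GoodOrdinaryRankZeroAtTwo) (hMult : MultiplicativeRankZeroAtTwo)
    (hSS : SupersingularRankZeroAtTwo) (hAdd : AdditiveRankZeroAtTwo) : RankZeroBSDTwo := by
  intro W _ _ hCM hr
  by_cases hg : W.HasGoodReductionAtPrime 2
  · by_cases hd : ((2 : ℕ) : ℤ) ∣ W.frobeniusTrace 2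
    · exact hSS W hCM hr ⟨hg, hd⟩
    · exact hOrd W hCM hr ⟨hg, hd⟩
  · by_cases hm : W.HasMultiplicativeReductionAtPrime 2
    · exact hMult W hCM hr hm
    · exact hAdd W hCM hr ⟨hg, hm⟩

/-- ★ **KEX⁰|Ш ⟸ DIV|Ш + RIG + RIG⁺ + NDIV|Ш-slack** (modulo Gross–Zagier + modularity, used only to know that `P(1)` has infinite order, so that an exact
`2`-depth EXISTS in the finitely generated `W(K[1])`).  At that depth: on the tight locus the equality is `core_eq_of_upper_of_rig_of_tight` (NO lower
half); on a frame tight for the two-sided count likewise with RIG⁺ (v1.2); on the slack locus it is `Nat.dvd_antisymm` of DIV|Ш and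
NDIV|Ш-slack.  CONDITIONAL; closes nothing.
[cite: GrossZagier1986, V.§2 (2.2)] [cite: GrossLMS1991, §2] -/
theorem kexSha_of_upper_of_rig_of_lowerSlack
    (hGZ : ∀ (N : ℕ) [NeZero N] (W : WeierstrassCurve ℚ) (K : Type) [Field K] [NumberField K], gross_zagier N W K)
    (hmod : hasEntireLFunction_rat)
    (hU : HeegnerIndexUpperShaCellAtTwo) (hR : SelmerExcessInjectsShaCellAtTwo) (hR2 : TwinSplitInjectsShaCellAtTwo)
    (hL : HeegnerIndexLowerSlackShaCellAtTwo) :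
    HeegnerIndexRelationShaCellAtTwo := by
  intro W _ _ _ hcm hr hT2 hSel K _ _ hK hodd h3 hH h2K Wd _ _ hWd hLv Dt β ι d₁
  -- `P(1)` has infinite order (Gross–Zagier); its exact `2`-depth exists (Mordell–Weil over `K[1]`)
  have hy : ¬ IsOfFinAddOrder d₁.derivedPoint :=
    not_isOfFinAddOrder_derivedPoint_one_of_rankOne_of_lValue_ne_zero hmod W K (hGZ _ W K) hK hH hr hLv d₁
  haveI := (finiteDimensional_and_isGalois_ringClassField hK ι one_ne_zero).1
  haveI : NumberField (ringClassField K ι 1) := NumberField.of_module_finite K _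
  haveI : (W.baseChange (ringClassField K ι 1)).IsElliptic := by rw [baseChange]; infer_instance
  haveI : Module.Finite ℤ (W.baseChange (ringClassField K ι 1)).toAffine.Point := by
    convert (W.baseChange (ringClassField K ι 1)).module_finite_point_holds
  obtain ⟨M₀, hdiv, hndiv⟩ := exists_exactTwoDepth
    (A := (W.baseChange (ringClassField K ι 1)).toAffine.Point) (y := d₁.derivedPoint) (by convert hy)
  have hup := hU W hcm hr hT2 hSel K hK hodd h3 hH h2K Wd hWd hLv Dt β ι d₁ M₀ hdiv hndiv
  have hrig := hR W hcm hr hT2 hSel K hK hodd h3 hH h2K Wd hWd hLv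
  have hP : 0 < 2 ^ (2 * M₀) := by positivity
  refine ⟨M₀, hdiv, hndiv, ?_⟩
  by_cases htight : 2 * 2 ^ (2 * M₀) ≤
      Nat.card (W.selmerGroup 2) * 2 ^ (2 * (padicValInt 2 Dt.c + padicValNat 2 W.tamagawaProduct))
  · -- tight locus: the upper half + rigidity already give the equality
    exact core_eq_of_upper_of_rig_of_tight hP hup hrig htight
  · by_cases htight2 : 2 * 2 ^ (2 * M₀) ≤
        Nat.card (W.selmerGroup 2) * Nat.card (AddCommGroup.primaryComponent Wd.sha 2) * 2 ^ (2 * kramerCount W K) *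
          2 ^ (2 * (padicValInt 2 Dt.c + padicValNat 2 W.tamagawaProduct))
    · -- tight for the two-sided count (v1.2): the upper half + RIG⁺ give the equality
      exact core_eq_of_upper_of_rig_of_tight hP hup (hR2 W hcm hr hT2 hSel K hK hodd h3 hH h2K Wd hWd hLv) htight2
    · -- slack locus: the lower-half stub applies
      exact Nat.dvd_antisymm hup (hL W hcm hr hT2 hSel K hK hodd h3 hH h2K Wd hWd hLv Dt β ι d₁ M₀ hdiv hndiv (not_le.mp htight)
        (not_le.mp htight2))

/-- Uniqueness of the exact `2`-depth of a point (used for losslessness). [folklore] -/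
theorem exactTwoDepth_unique {A : Type*} [AddCommGroup A] {y : A} {a b : ℕ}
    (ha : ∃ Q : A, ((2 ^ a : ℕ) : ℤ) • Q = y) (ha' : ¬ ∃ Q : A, ((2 ^ (a + 1) : ℕ) : ℤ) • Q = y)
    (hb : ∃ Q : A, ((2 ^ b : ℕ) : ℤ) • Q = y) (hb' : ¬ ∃ Q : A, ((2 ^ (b + 1) : ℕ) : ℤ) • Q = y) : a = b := by
  by_contra hab
  rcases Nat.lt_or_gt_of_ne hab with h | h
  · obtain ⟨Q, hQ⟩ := hb
    exact ha' ⟨((2 ^ (b - (a + 1)) : ℕ) : ℤ) • Q, by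
      rw [smul_smul, ← hQ]; congr 1; rw [← Nat.cast_mul, ← pow_add]; congr 2; omega⟩
  · obtain ⟨Q, hQ⟩ := ha
    exact hb' ⟨((2 ^ (a - (b + 1)) : ℕ) : ℤ) • Q, by
      rw [smul_smul, ← hQ]; congr 1; rw [← Nat.cast_mul, ← pow_add]; congr 2; omega⟩

/-- **DIV|Ш and NDIV|Ш-slack are LOSSLESS**: KEX⁰|Ш ⟹ both (the exact depth is unique).  With the LEAD's converse
`kex0Sha_of_shaCell_of_wall_of_facts` (the crux + S1′ + PRINT ⟹ KEX⁰|Ш) neither research stub is stronger than the crux modulo the wall and print.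
[folklore] -/
theorem halves_of_kexSha (hKEX : HeegnerIndexRelationShaCellAtTwo) :
    HeegnerIndexUpperShaCellAtTwo ∧ HeegnerIndexLowerSlackShaCellAtTwo := by
  refine ⟨?_, ?_⟩
  · intro W _ _ _ hcm hr hT2 hSel K _ _ hK hodd h3 hH h2K Wd _ _ hWd hLv Dt β ι d₁ M₀ hdiv hndiv
    obtain ⟨M₁, hdiv₁, hndiv₁, heq⟩ := hKEX W hcm hr hT2 hSel K hK hodd h3 hH h2K Wd hWd hLv Dt β ι d₁
    rw [exactTwoDepth_unique hdiv hndiv hdiv₁ hndiv₁, ← heq]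
  · intro W _ _ _ hcm hr hT2 hSel K _ _ hK hodd h3 hH h2K Wd _ _ hWd hLv Dt β ι d₁ M₀ hdiv hndiv _ _
    obtain ⟨M₁, hdiv₁, hndiv₁, heq⟩ := hKEX W hcm hr hT2 hSel K hK hodd h3 hH h2K Wd hWd hLv Dt β ι d₁
    rw [exactTwoDepth_unique hdiv hndiv hdiv₁ hndiv₁, ← heq]

/-- ★ **THE CRUX + S1′ + PRINT ⟹ both research halves** (LEAD g32's lossless converse p801119 + uniqueness of the exact depth).  CONDITIONAL. -/
theorem halves_of_shaCell_of_wall_of_facts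
    (hGZ : ∀ (N : ℕ) [NeZero N] (W : WeierstrassCurve ℚ) (K : Type) [Field K] [NumberField K], gross_zagier N W K)
    (hGZK : rank_eq_analyticRank_of_analyticRank_le_one) (hmod : hasEntireLFunction_rat)
    (hMilneC : Milne1972.bsdQuotient_baseChange_quadratic_anyModel) (h1 : RankZeroBSDTwo)
    (hCell : Summit.BirchSwinnertonDyer.BirchSwinnertonDyer.Theses.GenusKolyvaginAtTwo.RankOneShaCellBSDTwo) :
    HeegnerIndexUpperShaCellAtTwo ∧ HeegnerIndexLowerSlackShaCellAtTwo :=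
  halves_of_kexSha (kex0Sha_of_shaCell_of_wall_of_facts hGZ hGZK hmod hMilneC h1 hCell)

/-- v1.6 · the exponent bookkeeping: under PAR's parity, `Σ i_ℓ + 𝟙[0 < Δ] − 1 = 2·⌊Σ i_ℓ/2⌋` (both signs of `Δ ≠ 0`). -/
theorem kramer_exponent_arith {σ : ℕ} {Δ : ℚ} (hΔ : Δ ≠ 0) (hpar : σ % 2 = if Δ < 0 then 1 else 0) :
    σ + (if 0 < Δ then 1 else 0) - 1 = 2 * (σ / 2) := by
  rcases lt_or_gt_of_ne hΔ with h | h
  · have h' : ¬ 0 < Δ := not_lt.mpr h.le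
    rw [if_pos h] at hpar; rw [if_neg h']; omega
  · have h' : ¬ Δ < 0 := not_lt.mpr h.le
    rw [if_neg h'] at hpar; rw [if_pos h]; omega

/-- v1.6 · RIG⁺ ⟸ ISO₂ at the level of orders: if `#Ш(W_K)[2^∞] = #Ш(W)[2^∞]·#Ш(Wd)[2^∞]·2^{2κ}` (ISO₂ + PAR), `#Sel₂(W) = 2·#Ш(W)[2]` (descent count at
rank one, no `2`-torsion) and `#Ш(W)[2] ∣ #Ш(W)[2^∞]`, then `#Sel₂(W)·#Ш(Wd)[2^∞]·2^{2κ} ∣ 2·#Ш(W_K)[2^∞]` — RIG⁺'s conclusion; the quotient is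
`[Ш(W)[2^∞] : Ш(W)[2]]`, the slack of the cell. -/
theorem rigPlus_arith_of_bookkeeping {C A A₂ B S κ : ℕ} (hC : C = A * B * 2 ^ (2 * κ)) (hS : S = 2 * A₂) (hA : A₂ ∣ A) :
    S * B * 2 ^ (2 * κ) ∣ 2 * C := by
  obtain ⟨q, rfl⟩ := hA
  subst hC; subst hS
  exact ⟨q, by ring⟩

/-! ## The composition -/

/-- COMPOSITION with displayed inputs (kernel-checked, no sorry of its own): S1′ + DIV|Ш + RIG + RIG⁺ + NDIV|Ш-slack + PRINT×6 prove the Ш-cell text, via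
LEAD g32's engine `shaCell_of_wall_of_friedbergHoffstein_of_kex0Sha_of_facts` fed with KEX⁰|Ш := `kexSha_of_upper_of_rig_of_lowerSlack`. -/
theorem shaCell_of_inputs (h1 : RankZeroBSDTwo) (hU : HeegnerIndexUpperShaCellAtTwo) (hR : SelmerExcessInjectsShaCellAtTwo)
    (hR2 : TwinSplitInjectsShaCellAtTwo) (hL : HeegnerIndexLowerSlackShaCellAtTwo)
    (hGZ : GrossZagierAllLevels) (hGZK : MultPublishedInputsAtTwo) (hLf : EntireLFunctionRat) (hMi : MilneAnyModel)
    (hMP : nonempty_modularParametrizationData) (hFH : friedbergHoffstein_exists_heegnerField_split_twist_ne_zero) :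
    ∀ (W : WeierstrassCurve ℚ) [W.IsElliptic] [W.IsGloballyMinimal],
      ¬ W.HasCM → W.analyticRank = 1 → (∀ P : W.toAffine.Point, 2 • P = 0 → P = 0) → Nat.card (W.selmerGroup 2) ≠ 2 →
        Literature.NumberTheory.EllipticCurves.BSDp W 2 :=
  shaCell_of_wall_of_friedbergHoffstein_of_kex0Sha_of_facts hGZ hGZK hLf hMi hMP hFH h1 (kexSha_of_upper_of_rig_of_lowerSlack hGZ hLf hU hR hR2 hL)

/-- **THE LINE CONCLUDES THE CRUX BY NAME**: `RankOneShaCellBSDTwo` (stmt-BirchSwinnertonDyer-27477) from the seven stubs.  Sorry-free outside the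
stubs; one cell, no converse used, no residual locus.  BSD is NOT proved by this. -/
theorem RankOneShaCellBSDTwo_of : Summit.BirchSwinnertonDyer.BirchSwinnertonDyer.Theses.GenusKolyvaginAtTwo.RankOneShaCellBSDTwo :=
  shaCell_of_inputs
    (rankZeroBSDTwo_of_wall stub_wallRankZeroAtTwo.1 stub_wallRankZeroAtTwo.2.1 stub_wallRankZeroAtTwo.2.2.1 stub_wallRankZeroAtTwo.2.2.2)
    (heegnerIndexUpper_of_oneBit_of_square stub_heegnerIndexUpperOneBit stub_shaTwoPrimarySquare)
    (stub_selmerExcessInjects stub_printFacts.2.1 stub_printFacts.2.2.1) (stub_twinSplitInjects stub_printFacts.2.1 stub_printFacts.2.2.1)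
    stub_heegnerIndexLowerSlack
    stub_printFacts.1 stub_printFacts.2.1 stub_printFacts.2.2.1 stub_printFacts.2.2.2.1 stub_printFacts.2.2.2.2.1 stub_printFacts.2.2.2.2.2

end Summit.BirchSwinnertonDyer.BirchSwinnertonDyer.Cruxes.RankOneShaCellBSDTwo.RestrictionRigidity
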